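import Literature.AlgebraicGeometry.ModuliOfAbelianVarieties.SiegelAdelicMarkingLevelGlue
import Literature.AlgebraicGeometry.ModuliOfAbelianVarieties.SiegelAdelicMarkingConjugateTransport
import Literature.AlgebraicGeometry.AbelianSchemes.AbelianSchemeOverFibreIdentity
import HarnessLib

/-!
# The X + LEVEL clauses of the triple transport along `𝟙 (Spec ℂ)` from the marked-fibre data of the W3 road
# ([Milne 2005] Thm. 6.11 p. 74 «an isomorphism `A → A′` … sending `ηK` to `η′K`», §14 pp. 124–125; [MFK94] Def. 7.3 p. 130)

Topic `AlgebraicGeometry/ModuliOfAbelianVarieties`; namespace `Literature.AlgebraicGeometry.ModuliOfAbelianVarieties.SiegelAdelicMarking`.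
Cell hodgecm-mathlib (D-0151), rung-0 (P)-layer skeleton `M1primeOfFU`, stub W3, hypothesis **H3 `TripleTransportAlongId`** of
the `stub_W3` assembly (B-p11 2026-08-29T01:07:27Z, B-plan1 R12): this file is its **X + LEVEL half** as ONE theorem, assembled
from ★ leaves BY NAME — ★ R60-57b `isIso_of_forall_adelicCongr` (the transferred `f_B : B^σ ⟶ B″` is an isomorphism),
★ p684288 `map_restrictPt_level_eq_of_conj_of_hom_eq` ((c-iv-glue): `jσ ≫ f_B` carries level sections to level sections),
★ p682042 `AbelianSchemeOver.isBaseChangeVia_id_of_fibreIso` / `levelStructure_isBaseChangeVia_id_of_fibreIso` ((c-i)/(c-iv):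
an isomorphism of the identity fibres carrying `σᵢ(𝟙)` to `σ″ᵢ(𝟙)` is a base change of group schemes WITH level structures
along `𝟙`).  THEOREMS ONLY (no definition, no named fact, no instance, no `sorry`).  What H3 must still add: the dual
transport + Poincaré clause ((c-ii), B-p01) and the `λ`-clause ((c-iii), B-p03) for the SAME fibre isomorphism `h`
(exported here with `h.hom = jσ.hom ≫ f_B`).  HC_CM is proved only modulo the 7 printed citations until rung 0 closes.

## Setting (the H3 binders it consumes)
`Aσ, A′, A″` abelian schemes over `Spec ℂ` with level-`N` structures `φσ, φ′, φ″` (in the W3 road: `Pσ.A`, `P′.A`, `P″.A`);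
`jσ : Aσ(𝟙) ≅ A′(𝟙)^σ` the fibre junction of the `σ`-re-base, reading `(·)^σ` on the level sections (`hjσ`, H1's export);
markings `m₁` of `A′(𝟙)` by `[J, a]` and `m₂` of `A″(𝟙)` by `[J′, a′]` with symplectic-lift towers `Λ₁, Λ₂` read through
`a, a′` (the `MarkedBy` tower clauses); `f_B : A′(𝟙)^σ ⟶ A″(𝟙)` with the ★ `IsModuli` transfer clause for a fixed
`k ∈ K_δ(N)` (`ConjHomCompat`, supplied by H2 = ★ `exists_hom_conjugate_forall_adelicCongr_of_forall`).

## References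
* [Milne2005ShimuraVarieties] J. S. Milne, *Introduction to Shimura varieties* (2005), §6 Thm. 6.11 p. 74 and p. 75, §14
  pp. 124–125 (hypothesis of Prop. 14.12 p. 125).
* [MumfordFogartyKirwan1994] D. Mumford, J. Fogarty, F. Kirwan, *Geometric Invariant Theory* (3rd ed. 1994), Ch. 7 §2
  Def. 7.3 p. 130 (the pull-back relation of the moduli functor).
* [Deligne1971TravauxShimura] P. Deligne, *Travaux de Shimura*, Sém. Bourbaki 389 (1971), 4.16 p. 150, proof of 4.21 p. 152.
-/

set_option autoImplicit false

noncomputable section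

open Matrix CategoryTheory AlgebraicGeometry
open Literature.AlgebraicGeometry.Motives (AbelianVariety AlgPoints CartierDivisor)
open Literature.AlgebraicGeometry.AbelianSchemes (AbelianSchemeOver)
open Literature.AlgebraicGeometry.AbelianSchemes.AbelianSchemeOver (grpIsoOfFibreIso isBaseChangeVia_id_of_fibreIso
  levelStructure_isBaseChangeVia_id_of_fibreIso)

namespace Literature.AlgebraicGeometry.ModuliOfAbelianVarieties

namespace SiegelAdelicMarking

variable {g N : ℕ} {δ : Fin g → ℕ} {J J' : C0pm δ} {a a' k : gspFinAdelic δ}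
variable {Aσ A' A'' : AbelianSchemeOver (Spec (.of ℂ))}
  {φσ : Aσ.LevelStructure g N} {φ' : A'.LevelStructure g N} {φ'' : A''.LevelStructure g N}
  {Θ₁ : CartierDivisor (A'.fibre (𝟙 (Spec (.of ℂ)))).toAbelianVariety.X.left}
  {Θ₂ : CartierDivisor (A''.fibre (𝟙 (Spec (.of ℂ)))).toAbelianVariety.X.left}

/-! ### §1. The transferred `f_B` is an isomorphism; the composite fibre isomorphism `h = jσ ≫ f_B` -/

/-- **The transferred `f_B : A′(𝟙)^σ ⟶ A″(𝟙)` of the W3 road is an ISOMORPHISM** (★ R60-57b for the fibre markings, `K_δ(N) ≤ K_δ(1)`).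
[cite: Milne2005ShimuraVarieties, §6 Thm. 6.11 p. 74, §14 pp. 124–125] [cite: Deligne1971TravauxShimura, Exemple 4.16 p. 150] -/
theorem isIso_of_mem_principalLevelSubgroup_forall_adelicCongr (σ : ℂ ≃ₐ[ℚ] ℂ)
    (hk : k ∈ principalLevelSubgroup δ N) {B B'' : AbelianVariety ℂ}
    (m₁ : SiegelAdelicMarking J a B) (m₂ : SiegelAdelicMarking J' a' B'') (f : B.conjugate σ.toRingEquiv ⟶ B'')
    (hf : ∀ v w : Fin g ⊕ Fin g → ℚ,
      AdelicCongr ((k * a⁻¹ : gspFinAdelic δ) : GL (Fin g ⊕ Fin g) finAdeleQ)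
          ((a'⁻¹ : gspFinAdelic δ) : GL (Fin g ⊕ Fin g) finAdeleQ) v w →
        AlgPoints.map f.hom.hom.hom (B.conjPoints σ.toRingEquiv (m₁.r v)) = m₂.r w) :
    IsIso f :=
  isIso_of_forall_adelicCongr m₁ m₂ σ f (principalLevelSubgroup_anti δ (one_dvd N) hk) hf

/-! ### §2. The X + LEVEL half of H3 -/

/-- **X + LEVEL CLAUSES OF THE TRIPLE TRANSPORT ALONG `𝟙 (Spec ℂ)`** ([Milne2005ShimuraVarieties] Thm. 6.11 / §14 p. 125 read
through [MumfordFogartyKirwan1994] Def. 7.3): from the fibre junction `jσ : Aσ(𝟙) ≅ A′(𝟙)^σ` reading `(·)^σ` on the level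
sections, the two marked towers `(m₁, Λ₁)`, `(m₂, Λ₂)` and the transferred `f_B : A′(𝟙)^σ ⟶ A″(𝟙)` level-compatible for
`k ∈ K_δ(N)`, there is a fibre isomorphism `h : Aσ(𝟙) ≅ A″(𝟙)` with `h.hom = jσ.hom ≫ f_B` whose induced group-scheme
isomorphism `H := (grpIsoOfFibreIso Aσ A″ h).hom` exhibits `Aσ` as the base change of `A″` along `𝟙` AS GROUP SCHEMES WITH
LEVEL STRUCTURE (`φσ.IsBaseChangeVia φ″ (𝟙 _) H.left`).  The (c-ii) dual transport and the (c-iii) `λ`-clause of H3 are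
to be proved for this same `h`. [cite: Milne2005ShimuraVarieties, §6 Thm. 6.11 p. 74 and p. 75, §14 pp. 124–125]
[cite: MumfordFogartyKirwan1994, Ch. 7 §2 Definition 7.3 (p. 130)] [cite: Deligne1971TravauxShimura, 4.16 p. 150] -/
theorem exists_fibreIso_levelStructure_isBaseChangeVia_id (hN : N ≠ 0) (σ : ℂ ≃ₐ[ℚ] ℂ)
    (hk : k ∈ principalLevelSubgroup δ N)
    (jσ : (Aσ.fibre (𝟙 (Spec (.of ℂ)))).toAbelianVariety ≅
      ((A'.fibre (𝟙 (Spec (.of ℂ)))).toAbelianVariety).conjugate σ.toRingEquiv)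
    (hjσ : ∀ i, AlgPoints.map jσ.hom.hom.hom.hom (Aσ.restrictPt (𝟙 (Spec (.of ℂ))) (φσ.σ i)) =
      ((A'.fibre (𝟙 (Spec (.of ℂ)))).toAbelianVariety).conjPoints σ.toRingEquiv
        (A'.restrictPt (𝟙 (Spec (.of ℂ))) (φ'.σ i)))
    (Λ₁ : φ'.SymplecticLift (𝟙 (Spec (.of ℂ))) Θ₁ δ)
    (m₁ : SiegelAdelicMarking J a (A'.fibre (𝟙 (Spec (.of ℂ)))).toAbelianVariety)
    (hΛ₁ : ∀ ⦃M : ℕ⦄, N ∣ M → M ≠ 0 → ∀ (x : Fin g ⊕ Fin g → ZMod M) (v : Fin g ⊕ Fin g → ℚ),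
      AdelicCongr ((a⁻¹ : gspFinAdelic δ) : GL (Fin g ⊕ Fin g) finAdeleQ) 1 v (fun i => ((x i).val : ℚ) / M) →
        ((Λ₁.lift M (Multiplicative.ofAdd x)) : (A'.fibre (𝟙 (Spec (.of ℂ)))).toAbelianVariety.Points ℂ) = m₁.r v)
    (Λ₂ : φ''.SymplecticLift (𝟙 (Spec (.of ℂ))) Θ₂ δ)
    (m₂ : SiegelAdelicMarking J' a' (A''.fibre (𝟙 (Spec (.of ℂ)))).toAbelianVariety)
    (hΛ₂ : ∀ ⦃M : ℕ⦄, N ∣ M → M ≠ 0 → ∀ (x : Fin g ⊕ Fin g → ZMod M) (v : Fin g ⊕ Fin g → ℚ),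
      AdelicCongr ((a'⁻¹ : gspFinAdelic δ) : GL (Fin g ⊕ Fin g) finAdeleQ) 1 v (fun i => ((x i).val : ℚ) / M) →
        ((Λ₂.lift M (Multiplicative.ofAdd x)) : (A''.fibre (𝟙 (Spec (.of ℂ)))).toAbelianVariety.Points ℂ) = m₂.r v)
    (f_B : ((A'.fibre (𝟙 (Spec (.of ℂ)))).toAbelianVariety).conjugate σ.toRingEquiv ⟶
      (A''.fibre (𝟙 (Spec (.of ℂ)))).toAbelianVariety)
    (hf : ∀ v w : Fin g ⊕ Fin g → ℚ,
      AdelicCongr ((k * a⁻¹ : gspFinAdelic δ) : GL (Fin g ⊕ Fin g) finAdeleQ)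
          ((a'⁻¹ : gspFinAdelic δ) : GL (Fin g ⊕ Fin g) finAdeleQ) v w →
        AlgPoints.map f_B.hom.hom.hom
          (((A'.fibre (𝟙 (Spec (.of ℂ)))).toAbelianVariety).conjPoints σ.toRingEquiv (m₁.r v)) = m₂.r w) :
    ∃ h : (Aσ.fibre (𝟙 (Spec (.of ℂ)))).toAbelianVariety ≅ (A''.fibre (𝟙 (Spec (.of ℂ)))).toAbelianVariety,
      h.hom = jσ.hom ≫ f_B ∧
      Aσ.IsBaseChangeVia A'' (𝟙 (Spec (.of ℂ))) (grpIsoOfFibreIso Aσ A'' h).hom.hom.hom.left ∧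
      φσ.IsBaseChangeVia φ'' (𝟙 (Spec (.of ℂ))) (grpIsoOfFibreIso Aσ A'' h).hom.hom.hom.left := by
  haveI : IsIso f_B := isIso_of_mem_principalLevelSubgroup_forall_adelicCongr σ hk m₁ m₂ f_B hf
  refine ⟨jσ ≪≫ asIso f_B, rfl, isBaseChangeVia_id_of_fibreIso Aσ A'' _, ?_⟩
  exact levelStructure_isBaseChangeVia_id_of_fibreIso φσ φ'' (jσ ≪≫ asIso f_B)
    (map_restrictPt_level_eq_of_conj_of_hom_eq hN σ.toRingEquiv Λ₁ m₁ hΛ₁ Λ₂ m₂ hΛ₂ f_B ⟨k, hk, hf⟩ φσ jσ.hom hjσ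
      (jσ ≪≫ asIso f_B) rfl)

/-- **The same for a GIVEN fibre isomorphism `h` with `h.hom = jσ.hom ≫ f_B`** (so that the (c-ii)/(c-iii) clauses, proved for
an `h` of the consumer's choosing, and the X + level clauses speak of one morphism `H`).
[cite: Milne2005ShimuraVarieties, §6 Thm. 6.11 p. 74 and p. 75, §14 pp. 124–125] [cite: MumfordFogartyKirwan1994, Ch. 7 §2 Definition 7.3 (p. 130)] -/
theorem levelStructure_isBaseChangeVia_id_of_hom_eq (hN : N ≠ 0) (σ : ℂ ≃ₐ[ℚ] ℂ)
    (hk : k ∈ principalLevelSubgroup δ N)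
    (jσ : (Aσ.fibre (𝟙 (Spec (.of ℂ)))).toAbelianVariety ≅
      ((A'.fibre (𝟙 (Spec (.of ℂ)))).toAbelianVariety).conjugate σ.toRingEquiv)
    (hjσ : ∀ i, AlgPoints.map jσ.hom.hom.hom.hom (Aσ.restrictPt (𝟙 (Spec (.of ℂ))) (φσ.σ i)) =
      ((A'.fibre (𝟙 (Spec (.of ℂ)))).toAbelianVariety).conjPoints σ.toRingEquiv
        (A'.restrictPt (𝟙 (Spec (.of ℂ))) (φ'.σ i)))
    (Λ₁ : φ'.SymplecticLift (𝟙 (Spec (.of ℂ))) Θ₁ δ)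
    (m₁ : SiegelAdelicMarking J a (A'.fibre (𝟙 (Spec (.of ℂ)))).toAbelianVariety)
    (hΛ₁ : ∀ ⦃M : ℕ⦄, N ∣ M → M ≠ 0 → ∀ (x : Fin g ⊕ Fin g → ZMod M) (v : Fin g ⊕ Fin g → ℚ),
      AdelicCongr ((a⁻¹ : gspFinAdelic δ) : GL (Fin g ⊕ Fin g) finAdeleQ) 1 v (fun i => ((x i).val : ℚ) / M) →
        ((Λ₁.lift M (Multiplicative.ofAdd x)) : (A'.fibre (𝟙 (Spec (.of ℂ)))).toAbelianVariety.Points ℂ) = m₁.r v)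
    (Λ₂ : φ''.SymplecticLift (𝟙 (Spec (.of ℂ))) Θ₂ δ)
    (m₂ : SiegelAdelicMarking J' a' (A''.fibre (𝟙 (Spec (.of ℂ)))).toAbelianVariety)
    (hΛ₂ : ∀ ⦃M : ℕ⦄, N ∣ M → M ≠ 0 → ∀ (x : Fin g ⊕ Fin g → ZMod M) (v : Fin g ⊕ Fin g → ℚ),
      AdelicCongr ((a'⁻¹ : gspFinAdelic δ) : GL (Fin g ⊕ Fin g) finAdeleQ) 1 v (fun i => ((x i).val : ℚ) / M) →
        ((Λ₂.lift M (Multiplicative.ofAdd x)) : (A''.fibre (𝟙 (Spec (.of ℂ)))).toAbelianVariety.Points ℂ) = m₂.r v)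
    (f_B : ((A'.fibre (𝟙 (Spec (.of ℂ)))).toAbelianVariety).conjugate σ.toRingEquiv ⟶
      (A''.fibre (𝟙 (Spec (.of ℂ)))).toAbelianVariety)
    (hf : ∀ v w : Fin g ⊕ Fin g → ℚ,
      AdelicCongr ((k * a⁻¹ : gspFinAdelic δ) : GL (Fin g ⊕ Fin g) finAdeleQ)
          ((a'⁻¹ : gspFinAdelic δ) : GL (Fin g ⊕ Fin g) finAdeleQ) v w →
        AlgPoints.map f_B.hom.hom.hom
          (((A'.fibre (𝟙 (Spec (.of ℂ)))).toAbelianVariety).conjPoints σ.toRingEquiv (m₁.r v)) = m₂.r w)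
    (h : (Aσ.fibre (𝟙 (Spec (.of ℂ)))).toAbelianVariety ≅ (A''.fibre (𝟙 (Spec (.of ℂ)))).toAbelianVariety)
    (hh : h.hom = jσ.hom ≫ f_B) :
    φσ.IsBaseChangeVia φ'' (𝟙 (Spec (.of ℂ))) (grpIsoOfFibreIso Aσ A'' h).hom.hom.hom.left :=
  levelStructure_isBaseChangeVia_id_of_fibreIso φσ φ'' h
    (map_restrictPt_level_eq_of_conj_of_hom_eq hN σ.toRingEquiv Λ₁ m₁ hΛ₁ Λ₂ m₂ hΛ₂ f_B ⟨k, hk, hf⟩ φσ jσ.hom hjσ h hh)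

end SiegelAdelicMarking

end Literature.AlgebraicGeometry.ModuliOfAbelianVarieties

end
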